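import Summits.BirchSwinnertonDyer.BirchSwinnertonDyer.Theses.KolyvaginDepthDoor
import Summits.BirchSwinnertonDyer.BirchSwinnertonDyer.Theorems.KolyvaginDepthDoorKolyvaginDepthSupplySignedDatumKNDoor
import HarnessLib

/-!
# Route `KolyvaginDepthDoor`, support item `KolyvaginDoorKN` (stmt-BirchSwinnertonDyer-22821) — THE KN DOOR

Glue: `KolyvaginDepthSupplyKN → GrossFrobeniusCongruence → X1 on non-CM curves` (for every non-CM
globally minimal elliptic `E/ℚ` there is a prime `p ≥ 5` of good ordinary reduction with
`corank_{ℤ_p} Ш(E/ℚ)[p^∞] = 0`).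

The crux `KolyvaginDepthSupplyKN` is VERBATIM the tree definition
`Theorems.KolyvaginDepthDoor.KolyvaginDepthSupplySignedDatumKN` and `GrossFrobeniusCongruence` is by
definition (γ) = `GrossLMS1991.prop37_2_frobeniusCongruence`, so the landed door theorem
`Theorems.KolyvaginDepthDoor.shaCorank_eq_zero_nonCM_of_kolyvaginDepthSupplySignedDatumKN_print`
(kdd-p1 g9, p647397 lineage: Kolyvagin's structure theorem on the Kodaira–Néron cell derived from (γ)
alone) applies definitionally; we project its first four conjuncts.

This is an implication between two OPEN / print hypotheses and X1|nonCM; NOTHING class-wide is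
discharged and BSD is NOT proved by it.

References: [Kolyvagin1991MathAnn] Thm. 2.3, Thm. 4; [GrossLMS1991] Prop. 3.7 (2).
-/

set_option linter.dupNamespace false

namespace Summit.BirchSwinnertonDyer.BirchSwinnertonDyer.Theorems

open Summit.BirchSwinnertonDyer.BirchSwinnertonDyer.Theses.KolyvaginDepthDoor

/-- **The KN door** (item `KolyvaginDoorKN`, stmt-BirchSwinnertonDyer-22821): the KN signed datum
`KolyvaginDepthSupplyKN` together with (γ) `GrossFrobeniusCongruence` gives, for every non-CM globally
minimal elliptic curve over `ℚ`, a prime `p ≥ 5` of good ordinary reduction with `W.shaCorank p = 0`.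
Projection of `Theorems.KolyvaginDepthDoor.shaCorank_eq_zero_nonCM_of_kolyvaginDepthSupplySignedDatumKN_print`
(the crux body is that theorem's first hypothesis verbatim). BSD is not proved by this.
[cite: Kolyvagin1991MathAnn, Thm. 2.3] [cite: GrossLMS1991, Prop. 3.7 (2)] -/
theorem kolyvaginDoorKN_proof : KolyvaginDoorKN := by
  unfold KolyvaginDoorKN
  intro hS hγ W _ _ hcm
  obtain ⟨p, hp, h5, hgood, hord, hsha, -⟩ :=
    KolyvaginDepthDoor.shaCorank_eq_zero_nonCM_of_kolyvaginDepthSupplySignedDatumKN_print hS hγ W hcm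
  exact ⟨p, hp, h5, hgood, hord, hsha⟩

end Summit.BirchSwinnertonDyer.BirchSwinnertonDyer.Theorems
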